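import Summits.PneNP.PneNP.Theses.ConvexRankGates
import Summits.PneNP.PneNP.Theorems.ConvexRankGatesCliqueExtLowerBoundConvCalibration
import Summits.PneNP.PneNP.Theorems.ConvexRankGatesCliqueExtLowerBoundConvTwoRowsStructure

/-!
# Calibration of the reshaped stub `stub_convHighDim` (r5: `p ≥ 3 ∧ q ≥ 2`) and the three-stub bridge
(line `width-threshold-certificate-sparsity`, crux `ConvexRankGates.CliqueExtLowerBound`, stmt-PneNP-10682,
route PneNP/ConvexRankGates)

Reshape r5 of the line's skeleton weakens the CONV stub: by the landed `ConvTwoRows.conv_twoRows_structure`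
(a CONV gate with at most two constraint rows, any psd dimension, is an AND of at most two non-negatively
weighted real thresholds of its inputs) and the landed threshold assembly, only CONV gates with `p ≥ 3` rows AND
psd dimension `q ≥ 2` remain open. This file records, with the r5 stub text as an explicit arrow hypothesis
(verbatim) and everything else LANDED:

* `convSandwichable_of_convHighDim_r5` (REGISTERED): the r5 stub ⇒ ALL CONV gates of width `≤ m^c` are
  sandwichable (`q ≤ 1`: `ConvLowDim.stub_convLowDimStructure`; `p ≤ 2`: `ConvTwoRows.conv_twoRows_structure`;
  both through `AndThreshold.stub_andThresholdAssembly` with Muroga + threshold circuits; the rest is the stub);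
* `convHighDim_r4_of_r5`: the r5 stub ⇒ the r4 stub text (all `q ≥ 2` gates), so every r4 calibration applies:
* `convLowerBound_of_convHighDim_r5`, `oneConvGate_blind_of_convHighDim_r5`: the CONV-only lower bound at
  `δ = 1/4` and single-SDP-gate blindness from the r5 stub;
* `cliqueExtLowerBound_of_three_r5`: the crux from the three open r5 stubs `stub_permSandwichable`,
  `stub_grankSandwichable`, `stub_convHighDim` (r5), via `ConvCalibration.cliqueExtLowerBound_of_three`.

References: S. Jukna, *Boolean Function Complexity* (2012), Thm. 9.17 [Jukna2012].
-/

set_option linter.dupNamespace false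

open Literature.Computability.Complexity Filter Finset
open Summit.PneNP.PneNP.Theorems.CliqueExtLowerBound.WidthThreshold

noncomputable section

namespace Summit.PneNP.PneNP.Theorems.CliqueExtLowerBound.WidthThreshold.ConvCalibrationR5

/-! ## §1 All CONV gates are sandwichable from the r5 stub -/

open Classical in
/-- **All CONV gates of width `≤ m^c` are sandwichable from the r5 stub** (`p ≥ 3 ∧ q ≥ 2`; verbatim, as the
arrow hypothesis): split a CONV witness by `q ≤ 1` (landed `stub_convLowDimStructure`), else `p ≤ 2` (landed
`conv_twoRows_structure`) — both give an AND of `≤ (m^c+1)²` real thresholds, consumed by the landed assembly —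
else the stub. [cite: Jukna2012, Thm. 9.17] -/
theorem convSandwichable_of_convHighDim_r5 :
    (∀ c : ℕ, ∃ r₀ s₀ : ℕ, 2 ≤ r₀ ∧ 2 ≤ s₀ ∧ ∀ r s : ℕ, r₀ ≤ r → s₀ ≤ s →
      ∀ᶠ m : ℕ in atTop, ∀ φ : GateFn,
      (∃ p q : ℕ, p + q ≤ m ^ c ∧ 3 ≤ p ∧ 2 ≤ q ∧ ∃ (A : Fin p → Matrix (Fin q) (Fin q) ℝ) (b : Fin p → ℝ)
      (B : Fin p → Fin φ.1 → ℝ), (∀ i j, 0 ≤ B i j) ∧ ∀ v : Fin φ.1 → Bool, φ.2 v = true ↔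
      ∃ Y : Matrix (Fin q) (Fin q) ℝ, Y.PosSemidef ∧
      ∀ i, (A i * Y).trace ≤ b i + ∑ j, B i j * (if v j then (1 : ℝ) else 0)) →
      ∀ (D C : Fin φ.1 → Finset (Finset ((⊤ : SimpleGraph (Fin m)).edgeSet))),
      #(univ.image fun j => (D j, C j)) ≤ m ^ (c + 3) →
      (∀ j, ∀ R ∈ D j, #R ≤ r - 1) → (∀ j, ∀ S ∈ C j, #S ≤ s - 1) →
      (∀ j x, EvalDNF (D j) x → EvalCNF (C j) x) →
      ∃ dnf cnf : Finset (Finset ((⊤ : SimpleGraph (Fin m)).edgeSet)),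
      (∀ R ∈ dnf, #R ≤ r - 1) ∧ (∀ S ∈ cnf, #S ≤ s - 1) ∧
      (∀ x, EvalDNF dnf x → EvalCNF cnf x) ∧
      (#((posGraphs m ⌈(m : ℝ) ^ (1 / 4 : ℝ)⌉₊).filter
      (fun x => φ.2 (fun j => decide (EvalDNF (D j) x)) = true ∧ ¬ EvalDNF dnf x)) : ℝ)
      ≤ (1 / (8 * (m : ℝ) ^ (c + 1))) * #(posGraphs m ⌈(m : ℝ) ^ (1 / 4 : ℝ)⌉₊) ∧
      (#((((powersetCard (Fintype.card ((⊤ : SimpleGraph (Fin m)).edgeSet) / ⌊(m : ℝ) ^ (1 / 8 : ℝ)⌋₊)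
      (univ : Finset ((⊤ : SimpleGraph (Fin m)).edgeSet))).image (fun M => fun e => decide (e ∉ M)))).filter
      (fun x => EvalCNF cnf x ∧ φ.2 (fun j => decide (EvalCNF (C j) x)) = false)) : ℝ)
      ≤ (1 / (8 * (m : ℝ) ^ (c + 1))) *
      #(((powersetCard (Fintype.card ((⊤ : SimpleGraph (Fin m)).edgeSet) / ⌊(m : ℝ) ^ (1 / 8 : ℝ)⌋₊)
      (univ : Finset ((⊤ : SimpleGraph (Fin m)).edgeSet))).image (fun M => fun e => decide (e ∉ M))))) →
    ∀ c : ℕ, ∃ r₀ s₀ : ℕ, 2 ≤ r₀ ∧ 2 ≤ s₀ ∧ ∀ r s : ℕ, r₀ ≤ r → s₀ ≤ s →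
      ∀ᶠ m : ℕ in atTop, ∀ φ : GateFn, IsConvGate (m ^ c) φ →
        Sandwichable r s (m ^ (c + 3)) (posFam m) (negFam m) (eps m c) φ := by
  intro hH c
  obtain ⟨r₁, s₁, hr₁, hs₁, hHi⟩ := hH c
  obtain ⟨r₂, s₂, hr₂, hs₂, hLo⟩ :=
    Summit.PneNP.PneNP.Theorems.CliqueExtLowerBound.WidthThreshold.AndThreshold.stub_andThresholdAssembly
      Summit.PneNP.PneNP.Theorems.CliqueExtLowerBound.WidthThreshold.IntegerWeights.stub_thresholdIntegerWeights
      Summit.PneNP.PneNP.Theorems.CliqueExtLowerBound.WidthThreshold.ThresholdCircuit.stub_integerThresholdCircuit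
      c
  refine ⟨max r₁ r₂, max s₁ s₂, le_trans hr₁ (le_max_left _ _), le_trans hs₁ (le_max_left _ _),
    fun r s hr hs => ?_⟩
  filter_upwards [hHi r s ((le_max_left _ _).trans hr) ((le_max_left _ _).trans hs),
    hLo r s ((le_max_right _ _).trans hr) ((le_max_right _ _).trans hs)] with m h₁ h₂ φ hφ
  obtain ⟨p, q, hpq, A, b, B, hB, hrep⟩ := hφ
  by_cases hq : q ≤ 1
  · exact h₂ φ
      (Summit.PneNP.PneNP.Theorems.CliqueExtLowerBound.WidthThreshold.ConvLowDim.stub_convLowDimStructure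
        (m ^ c) φ ⟨p, q, hpq, hq, A, b, B, hB, hrep⟩)
  · by_cases hp : p ≤ 2
    · exact h₂ φ
        (Summit.PneNP.PneNP.Theorems.CliqueExtLowerBound.WidthThreshold.ConvTwoRows.conv_twoRows_structure
          (m ^ c) φ ⟨p, q, hpq, hp, A, b, B, hB, hrep⟩)
    · exact h₁ φ ⟨p, q, hpq, by omega, by omega, A, b, B, hB, hrep⟩

open Classical in
/-- **The r5 stub implies the r4 stub text** (all CONV gates with psd dimension `q ≥ 2`): the gates with
`q ≥ 2` but `p ≤ 2` rows are free by `conv_twoRows_structure` and the landed assembly. -/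
theorem convHighDim_r4_of_r5 :
    (∀ c : ℕ, ∃ r₀ s₀ : ℕ, 2 ≤ r₀ ∧ 2 ≤ s₀ ∧ ∀ r s : ℕ, r₀ ≤ r → s₀ ≤ s →
      ∀ᶠ m : ℕ in atTop, ∀ φ : GateFn,
      (∃ p q : ℕ, p + q ≤ m ^ c ∧ 3 ≤ p ∧ 2 ≤ q ∧ ∃ (A : Fin p → Matrix (Fin q) (Fin q) ℝ) (b : Fin p → ℝ)
      (B : Fin p → Fin φ.1 → ℝ), (∀ i j, 0 ≤ B i j) ∧ ∀ v : Fin φ.1 → Bool, φ.2 v = true ↔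
      ∃ Y : Matrix (Fin q) (Fin q) ℝ, Y.PosSemidef ∧
      ∀ i, (A i * Y).trace ≤ b i + ∑ j, B i j * (if v j then (1 : ℝ) else 0)) →
      ∀ (D C : Fin φ.1 → Finset (Finset ((⊤ : SimpleGraph (Fin m)).edgeSet))),
      #(univ.image fun j => (D j, C j)) ≤ m ^ (c + 3) →
      (∀ j, ∀ R ∈ D j, #R ≤ r - 1) → (∀ j, ∀ S ∈ C j, #S ≤ s - 1) →
      (∀ j x, EvalDNF (D j) x → EvalCNF (C j) x) →
      ∃ dnf cnf : Finset (Finset ((⊤ : SimpleGraph (Fin m)).edgeSet)),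
      (∀ R ∈ dnf, #R ≤ r - 1) ∧ (∀ S ∈ cnf, #S ≤ s - 1) ∧
      (∀ x, EvalDNF dnf x → EvalCNF cnf x) ∧
      (#((posGraphs m ⌈(m : ℝ) ^ (1 / 4 : ℝ)⌉₊).filter
      (fun x => φ.2 (fun j => decide (EvalDNF (D j) x)) = true ∧ ¬ EvalDNF dnf x)) : ℝ)
      ≤ (1 / (8 * (m : ℝ) ^ (c + 1))) * #(posGraphs m ⌈(m : ℝ) ^ (1 / 4 : ℝ)⌉₊) ∧
      (#((((powersetCard (Fintype.card ((⊤ : SimpleGraph (Fin m)).edgeSet) / ⌊(m : ℝ) ^ (1 / 8 : ℝ)⌋₊)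
      (univ : Finset ((⊤ : SimpleGraph (Fin m)).edgeSet))).image (fun M => fun e => decide (e ∉ M)))).filter
      (fun x => EvalCNF cnf x ∧ φ.2 (fun j => decide (EvalCNF (C j) x)) = false)) : ℝ)
      ≤ (1 / (8 * (m : ℝ) ^ (c + 1))) *
      #(((powersetCard (Fintype.card ((⊤ : SimpleGraph (Fin m)).edgeSet) / ⌊(m : ℝ) ^ (1 / 8 : ℝ)⌋₊)
      (univ : Finset ((⊤ : SimpleGraph (Fin m)).edgeSet))).image (fun M => fun e => decide (e ∉ M))))) →
    (∀ c : ℕ, ∃ r₀ s₀ : ℕ, 2 ≤ r₀ ∧ 2 ≤ s₀ ∧ ∀ r s : ℕ, r₀ ≤ r → s₀ ≤ s →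
      ∀ᶠ m : ℕ in atTop, ∀ φ : GateFn,
      (∃ p q : ℕ, p + q ≤ m ^ c ∧ 2 ≤ q ∧ ∃ (A : Fin p → Matrix (Fin q) (Fin q) ℝ) (b : Fin p → ℝ)
      (B : Fin p → Fin φ.1 → ℝ), (∀ i j, 0 ≤ B i j) ∧ ∀ v : Fin φ.1 → Bool, φ.2 v = true ↔
      ∃ Y : Matrix (Fin q) (Fin q) ℝ, Y.PosSemidef ∧
      ∀ i, (A i * Y).trace ≤ b i + ∑ j, B i j * (if v j then (1 : ℝ) else 0)) →
      ∀ (D C : Fin φ.1 → Finset (Finset ((⊤ : SimpleGraph (Fin m)).edgeSet))),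
      #(univ.image fun j => (D j, C j)) ≤ m ^ (c + 3) →
      (∀ j, ∀ R ∈ D j, #R ≤ r - 1) → (∀ j, ∀ S ∈ C j, #S ≤ s - 1) →
      (∀ j x, EvalDNF (D j) x → EvalCNF (C j) x) →
      ∃ dnf cnf : Finset (Finset ((⊤ : SimpleGraph (Fin m)).edgeSet)),
      (∀ R ∈ dnf, #R ≤ r - 1) ∧ (∀ S ∈ cnf, #S ≤ s - 1) ∧
      (∀ x, EvalDNF dnf x → EvalCNF cnf x) ∧
      (#((posGraphs m ⌈(m : ℝ) ^ (1 / 4 : ℝ)⌉₊).filter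
      (fun x => φ.2 (fun j => decide (EvalDNF (D j) x)) = true ∧ ¬ EvalDNF dnf x)) : ℝ)
      ≤ (1 / (8 * (m : ℝ) ^ (c + 1))) * #(posGraphs m ⌈(m : ℝ) ^ (1 / 4 : ℝ)⌉₊) ∧
      (#((((powersetCard (Fintype.card ((⊤ : SimpleGraph (Fin m)).edgeSet) / ⌊(m : ℝ) ^ (1 / 8 : ℝ)⌋₊)
      (univ : Finset ((⊤ : SimpleGraph (Fin m)).edgeSet))).image (fun M => fun e => decide (e ∉ M)))).filter
      (fun x => EvalCNF cnf x ∧ φ.2 (fun j => decide (EvalCNF (C j) x)) = false)) : ℝ)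
      ≤ (1 / (8 * (m : ℝ) ^ (c + 1))) *
      #(((powersetCard (Fintype.card ((⊤ : SimpleGraph (Fin m)).edgeSet) / ⌊(m : ℝ) ^ (1 / 8 : ℝ)⌋₊)
      (univ : Finset ((⊤ : SimpleGraph (Fin m)).edgeSet))).image (fun M => fun e => decide (e ∉ M))))) := by
  intro hH c
  obtain ⟨r₁, s₁, hr₁, hs₁, hHi⟩ := hH c
  obtain ⟨r₂, s₂, hr₂, hs₂, hLo⟩ :=
    Summit.PneNP.PneNP.Theorems.CliqueExtLowerBound.WidthThreshold.AndThreshold.stub_andThresholdAssembly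
      Summit.PneNP.PneNP.Theorems.CliqueExtLowerBound.WidthThreshold.IntegerWeights.stub_thresholdIntegerWeights
      Summit.PneNP.PneNP.Theorems.CliqueExtLowerBound.WidthThreshold.ThresholdCircuit.stub_integerThresholdCircuit
      c
  refine ⟨max r₁ r₂, max s₁ s₂, le_trans hr₁ (le_max_left _ _), le_trans hs₁ (le_max_left _ _),
    fun r s hr hs => ?_⟩
  filter_upwards [hHi r s ((le_max_left _ _).trans hr) ((le_max_left _ _).trans hs),
    hLo r s ((le_max_right _ _).trans hr) ((le_max_right _ _).trans hs)] with m h₁ h₂ φ hφ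
  obtain ⟨p, q, hpq, hq2, A, b, B, hB, hrep⟩ := hφ
  by_cases hp : p ≤ 2
  · exact h₂ φ
      (Summit.PneNP.PneNP.Theorems.CliqueExtLowerBound.WidthThreshold.ConvTwoRows.conv_twoRows_structure
        (m ^ c) φ ⟨p, q, hpq, hp, A, b, B, hB, hrep⟩)
  · exact h₁ φ ⟨p, q, hpq, by omega, hq2, A, b, B, hB, hrep⟩

/-! ## §2 Consequences carried over from the r4 calibration -/

open Classical in
/-- The CONV-only lower bound at `δ = 1/4` from the r5 stub: for every `c`, eventually in `m`, no circuit with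
`≤ m^c` gates over `{∧₂, ∨₂} ∪ CONV_{m^c}` computes `CLIQUE(m, ⌈m^{1/4}⌉₊)`. [cite: Jukna2012, Thm. 9.17] -/
theorem convLowerBound_of_convHighDim_r5 :
    (∀ c : ℕ, ∃ r₀ s₀ : ℕ, 2 ≤ r₀ ∧ 2 ≤ s₀ ∧ ∀ r s : ℕ, r₀ ≤ r → s₀ ≤ s →
      ∀ᶠ m : ℕ in atTop, ∀ φ : GateFn,
      (∃ p q : ℕ, p + q ≤ m ^ c ∧ 3 ≤ p ∧ 2 ≤ q ∧ ∃ (A : Fin p → Matrix (Fin q) (Fin q) ℝ) (b : Fin p → ℝ)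
      (B : Fin p → Fin φ.1 → ℝ), (∀ i j, 0 ≤ B i j) ∧ ∀ v : Fin φ.1 → Bool, φ.2 v = true ↔
      ∃ Y : Matrix (Fin q) (Fin q) ℝ, Y.PosSemidef ∧
      ∀ i, (A i * Y).trace ≤ b i + ∑ j, B i j * (if v j then (1 : ℝ) else 0)) →
      ∀ (D C : Fin φ.1 → Finset (Finset ((⊤ : SimpleGraph (Fin m)).edgeSet))),
      #(univ.image fun j => (D j, C j)) ≤ m ^ (c + 3) →
      (∀ j, ∀ R ∈ D j, #R ≤ r - 1) → (∀ j, ∀ S ∈ C j, #S ≤ s - 1) →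
      (∀ j x, EvalDNF (D j) x → EvalCNF (C j) x) →
      ∃ dnf cnf : Finset (Finset ((⊤ : SimpleGraph (Fin m)).edgeSet)),
      (∀ R ∈ dnf, #R ≤ r - 1) ∧ (∀ S ∈ cnf, #S ≤ s - 1) ∧
      (∀ x, EvalDNF dnf x → EvalCNF cnf x) ∧
      (#((posGraphs m ⌈(m : ℝ) ^ (1 / 4 : ℝ)⌉₊).filter
      (fun x => φ.2 (fun j => decide (EvalDNF (D j) x)) = true ∧ ¬ EvalDNF dnf x)) : ℝ)
      ≤ (1 / (8 * (m : ℝ) ^ (c + 1))) * #(posGraphs m ⌈(m : ℝ) ^ (1 / 4 : ℝ)⌉₊) ∧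
      (#((((powersetCard (Fintype.card ((⊤ : SimpleGraph (Fin m)).edgeSet) / ⌊(m : ℝ) ^ (1 / 8 : ℝ)⌋₊)
      (univ : Finset ((⊤ : SimpleGraph (Fin m)).edgeSet))).image (fun M => fun e => decide (e ∉ M)))).filter
      (fun x => EvalCNF cnf x ∧ φ.2 (fun j => decide (EvalCNF (C j) x)) = false)) : ℝ)
      ≤ (1 / (8 * (m : ℝ) ^ (c + 1))) *
      #(((powersetCard (Fintype.card ((⊤ : SimpleGraph (Fin m)).edgeSet) / ⌊(m : ℝ) ^ (1 / 8 : ℝ)⌋₊)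
      (univ : Finset ((⊤ : SimpleGraph (Fin m)).edgeSet))).image (fun M => fun e => decide (e ∉ M))))) →
    ∀ c : ℕ, ∀ᶠ m : ℕ in atTop, ∀ C : Circuit ((⊤ : SimpleGraph (Fin m)).edgeSet),
      C.IsOver ({GateFn.and 2, GateFn.or 2} ∪ {g | IsConvGate (m ^ c) g}) →
        C.size ≤ m ^ c → ¬ C.Computes (cliqueFn m ⌈(m : ℝ) ^ (1 / 4 : ℝ)⌉₊) :=
  fun hH => ConvCalibration.convLowerBound_of_convHighDim (convHighDim_r4_of_r5 hH)

open Classical in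
/-- Single-gate blindness from the r5 stub: for every `c`, eventually in `m`, NO single SDP-feasibility gate of
width `≤ m^c` (any arity, any wiring of its inputs to edges) computes `CLIQUE(m, ⌈m^{1/4}⌉₊)`. -/
theorem oneConvGate_blind_of_convHighDim_r5 :
    (∀ c : ℕ, ∃ r₀ s₀ : ℕ, 2 ≤ r₀ ∧ 2 ≤ s₀ ∧ ∀ r s : ℕ, r₀ ≤ r → s₀ ≤ s →
      ∀ᶠ m : ℕ in atTop, ∀ φ : GateFn,
      (∃ p q : ℕ, p + q ≤ m ^ c ∧ 3 ≤ p ∧ 2 ≤ q ∧ ∃ (A : Fin p → Matrix (Fin q) (Fin q) ℝ) (b : Fin p → ℝ)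
      (B : Fin p → Fin φ.1 → ℝ), (∀ i j, 0 ≤ B i j) ∧ ∀ v : Fin φ.1 → Bool, φ.2 v = true ↔
      ∃ Y : Matrix (Fin q) (Fin q) ℝ, Y.PosSemidef ∧
      ∀ i, (A i * Y).trace ≤ b i + ∑ j, B i j * (if v j then (1 : ℝ) else 0)) →
      ∀ (D C : Fin φ.1 → Finset (Finset ((⊤ : SimpleGraph (Fin m)).edgeSet))),
      #(univ.image fun j => (D j, C j)) ≤ m ^ (c + 3) →
      (∀ j, ∀ R ∈ D j, #R ≤ r - 1) → (∀ j, ∀ S ∈ C j, #S ≤ s - 1) →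
      (∀ j x, EvalDNF (D j) x → EvalCNF (C j) x) →
      ∃ dnf cnf : Finset (Finset ((⊤ : SimpleGraph (Fin m)).edgeSet)),
      (∀ R ∈ dnf, #R ≤ r - 1) ∧ (∀ S ∈ cnf, #S ≤ s - 1) ∧
      (∀ x, EvalDNF dnf x → EvalCNF cnf x) ∧
      (#((posGraphs m ⌈(m : ℝ) ^ (1 / 4 : ℝ)⌉₊).filter
      (fun x => φ.2 (fun j => decide (EvalDNF (D j) x)) = true ∧ ¬ EvalDNF dnf x)) : ℝ)
      ≤ (1 / (8 * (m : ℝ) ^ (c + 1))) * #(posGraphs m ⌈(m : ℝ) ^ (1 / 4 : ℝ)⌉₊) ∧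
      (#((((powersetCard (Fintype.card ((⊤ : SimpleGraph (Fin m)).edgeSet) / ⌊(m : ℝ) ^ (1 / 8 : ℝ)⌋₊)
      (univ : Finset ((⊤ : SimpleGraph (Fin m)).edgeSet))).image (fun M => fun e => decide (e ∉ M)))).filter
      (fun x => EvalCNF cnf x ∧ φ.2 (fun j => decide (EvalCNF (C j) x)) = false)) : ℝ)
      ≤ (1 / (8 * (m : ℝ) ^ (c + 1))) *
      #(((powersetCard (Fintype.card ((⊤ : SimpleGraph (Fin m)).edgeSet) / ⌊(m : ℝ) ^ (1 / 8 : ℝ)⌋₊)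
      (univ : Finset ((⊤ : SimpleGraph (Fin m)).edgeSet))).image (fun M => fun e => decide (e ∉ M))))) →
    ∀ c : ℕ, ∀ᶠ m : ℕ in atTop,
      ∀ (n : ℕ) (f : (Fin n → Bool) → Bool) (w : Fin n → (⊤ : SimpleGraph (Fin m)).edgeSet),
        IsConvGate (m ^ c) ⟨n, f⟩ →
        ¬ ∀ x : (⊤ : SimpleGraph (Fin m)).edgeSet → Bool,
          f (fun i => x (w i)) = cliqueFn m ⌈(m : ℝ) ^ (1 / 4 : ℝ)⌉₊ x :=
  fun hH => ConvCalibration.oneConvGate_blind_of_convHighDim (convHighDim_r4_of_r5 hH)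

/-! ## §3 The bridge: the crux from the three open r5 stubs -/

open Classical in
/-- **The crux from the three open r5 stubs** `stub_permSandwichable`, `stub_grankSandwichable` and
`stub_convHighDim` (r5: `p ≥ 3 ∧ q ≥ 2`), all verbatim as arrow hypotheses; everything else in the line is
landed. -/
theorem cliqueExtLowerBound_of_three_r5 :
    (∀ c : ℕ, ∃ r₀ s₀ : ℕ, 2 ≤ r₀ ∧ 2 ≤ s₀ ∧ ∀ r s : ℕ, r₀ ≤ r → s₀ ≤ s →
      ∀ᶠ m : ℕ in atTop, ∀ φ : GateFn, IsPermGate (m ^ c) φ →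
      ¬ (IsPermGate ⌊(m : ℝ) ^ (1 / 16 : ℝ)⌋₊ φ ∨ IsGRankGate ⌊(m : ℝ) ^ (1 / 16 : ℝ)⌋₊ φ) →
      ∀ (D C : Fin φ.1 → Finset (Finset ((⊤ : SimpleGraph (Fin m)).edgeSet))),
      #(univ.image fun j => (D j, C j)) ≤ m ^ (c + 3) →
      (∀ j, ∀ R ∈ D j, #R ≤ r - 1) → (∀ j, ∀ S ∈ C j, #S ≤ s - 1) →
      (∀ j x, EvalDNF (D j) x → EvalCNF (C j) x) →
      ∃ dnf cnf : Finset (Finset ((⊤ : SimpleGraph (Fin m)).edgeSet)),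
      (∀ R ∈ dnf, #R ≤ r - 1) ∧ (∀ S ∈ cnf, #S ≤ s - 1) ∧
      (∀ x, EvalDNF dnf x → EvalCNF cnf x) ∧
      (#((posGraphs m ⌈(m : ℝ) ^ (1 / 4 : ℝ)⌉₊).filter
      (fun x => φ.2 (fun j => decide (EvalDNF (D j) x)) = true ∧ ¬ EvalDNF dnf x)) : ℝ)
      ≤ (1 / (8 * (m : ℝ) ^ (c + 1))) * #(posGraphs m ⌈(m : ℝ) ^ (1 / 4 : ℝ)⌉₊) ∧
      (#((((powersetCard (Fintype.card ((⊤ : SimpleGraph (Fin m)).edgeSet) / ⌊(m : ℝ) ^ (1 / 8 : ℝ)⌋₊)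
      (univ : Finset ((⊤ : SimpleGraph (Fin m)).edgeSet))).image (fun M => fun e => decide (e ∉ M)))).filter
      (fun x => EvalCNF cnf x ∧ φ.2 (fun j => decide (EvalCNF (C j) x)) = false)) : ℝ)
      ≤ (1 / (8 * (m : ℝ) ^ (c + 1))) *
      #(((powersetCard (Fintype.card ((⊤ : SimpleGraph (Fin m)).edgeSet) / ⌊(m : ℝ) ^ (1 / 8 : ℝ)⌋₊)
      (univ : Finset ((⊤ : SimpleGraph (Fin m)).edgeSet))).image (fun M => fun e => decide (e ∉ M))))) →
    (∀ c : ℕ, ∃ r₀ s₀ : ℕ, 2 ≤ r₀ ∧ 2 ≤ s₀ ∧ ∀ r s : ℕ, r₀ ≤ r → s₀ ≤ s →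
      ∀ᶠ m : ℕ in atTop, ∀ φ : GateFn, IsGRankGate (m ^ c) φ →
      ¬ (IsPermGate ⌊(m : ℝ) ^ (1 / 16 : ℝ)⌋₊ φ ∨ IsGRankGate ⌊(m : ℝ) ^ (1 / 16 : ℝ)⌋₊ φ) →
      ∀ (D C : Fin φ.1 → Finset (Finset ((⊤ : SimpleGraph (Fin m)).edgeSet))),
      #(univ.image fun j => (D j, C j)) ≤ m ^ (c + 3) →
      (∀ j, ∀ R ∈ D j, #R ≤ r - 1) → (∀ j, ∀ S ∈ C j, #S ≤ s - 1) →
      (∀ j x, EvalDNF (D j) x → EvalCNF (C j) x) →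
      ∃ dnf cnf : Finset (Finset ((⊤ : SimpleGraph (Fin m)).edgeSet)),
      (∀ R ∈ dnf, #R ≤ r - 1) ∧ (∀ S ∈ cnf, #S ≤ s - 1) ∧
      (∀ x, EvalDNF dnf x → EvalCNF cnf x) ∧
      (#((posGraphs m ⌈(m : ℝ) ^ (1 / 4 : ℝ)⌉₊).filter
      (fun x => φ.2 (fun j => decide (EvalDNF (D j) x)) = true ∧ ¬ EvalDNF dnf x)) : ℝ)
      ≤ (1 / (8 * (m : ℝ) ^ (c + 1))) * #(posGraphs m ⌈(m : ℝ) ^ (1 / 4 : ℝ)⌉₊) ∧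
      (#((((powersetCard (Fintype.card ((⊤ : SimpleGraph (Fin m)).edgeSet) / ⌊(m : ℝ) ^ (1 / 8 : ℝ)⌋₊)
      (univ : Finset ((⊤ : SimpleGraph (Fin m)).edgeSet))).image (fun M => fun e => decide (e ∉ M)))).filter
      (fun x => EvalCNF cnf x ∧ φ.2 (fun j => decide (EvalCNF (C j) x)) = false)) : ℝ)
      ≤ (1 / (8 * (m : ℝ) ^ (c + 1))) *
      #(((powersetCard (Fintype.card ((⊤ : SimpleGraph (Fin m)).edgeSet) / ⌊(m : ℝ) ^ (1 / 8 : ℝ)⌋₊)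
      (univ : Finset ((⊤ : SimpleGraph (Fin m)).edgeSet))).image (fun M => fun e => decide (e ∉ M))))) →
    (∀ c : ℕ, ∃ r₀ s₀ : ℕ, 2 ≤ r₀ ∧ 2 ≤ s₀ ∧ ∀ r s : ℕ, r₀ ≤ r → s₀ ≤ s →
      ∀ᶠ m : ℕ in atTop, ∀ φ : GateFn,
      (∃ p q : ℕ, p + q ≤ m ^ c ∧ 3 ≤ p ∧ 2 ≤ q ∧ ∃ (A : Fin p → Matrix (Fin q) (Fin q) ℝ) (b : Fin p → ℝ)
      (B : Fin p → Fin φ.1 → ℝ), (∀ i j, 0 ≤ B i j) ∧ ∀ v : Fin φ.1 → Bool, φ.2 v = true ↔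
      ∃ Y : Matrix (Fin q) (Fin q) ℝ, Y.PosSemidef ∧
      ∀ i, (A i * Y).trace ≤ b i + ∑ j, B i j * (if v j then (1 : ℝ) else 0)) →
      ∀ (D C : Fin φ.1 → Finset (Finset ((⊤ : SimpleGraph (Fin m)).edgeSet))),
      #(univ.image fun j => (D j, C j)) ≤ m ^ (c + 3) →
      (∀ j, ∀ R ∈ D j, #R ≤ r - 1) → (∀ j, ∀ S ∈ C j, #S ≤ s - 1) →
      (∀ j x, EvalDNF (D j) x → EvalCNF (C j) x) →
      ∃ dnf cnf : Finset (Finset ((⊤ : SimpleGraph (Fin m)).edgeSet)),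
      (∀ R ∈ dnf, #R ≤ r - 1) ∧ (∀ S ∈ cnf, #S ≤ s - 1) ∧
      (∀ x, EvalDNF dnf x → EvalCNF cnf x) ∧
      (#((posGraphs m ⌈(m : ℝ) ^ (1 / 4 : ℝ)⌉₊).filter
      (fun x => φ.2 (fun j => decide (EvalDNF (D j) x)) = true ∧ ¬ EvalDNF dnf x)) : ℝ)
      ≤ (1 / (8 * (m : ℝ) ^ (c + 1))) * #(posGraphs m ⌈(m : ℝ) ^ (1 / 4 : ℝ)⌉₊) ∧
      (#((((powersetCard (Fintype.card ((⊤ : SimpleGraph (Fin m)).edgeSet) / ⌊(m : ℝ) ^ (1 / 8 : ℝ)⌋₊)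
      (univ : Finset ((⊤ : SimpleGraph (Fin m)).edgeSet))).image (fun M => fun e => decide (e ∉ M)))).filter
      (fun x => EvalCNF cnf x ∧ φ.2 (fun j => decide (EvalCNF (C j) x)) = false)) : ℝ)
      ≤ (1 / (8 * (m : ℝ) ^ (c + 1))) *
      #(((powersetCard (Fintype.card ((⊤ : SimpleGraph (Fin m)).edgeSet) / ⌊(m : ℝ) ^ (1 / 8 : ℝ)⌋₊)
      (univ : Finset ((⊤ : SimpleGraph (Fin m)).edgeSet))).image (fun M => fun e => decide (e ∉ M))))) →
    Summit.PneNP.PneNP.Theses.ConvexRankGates.CliqueExtLowerBound :=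
  fun hP hG hH => ConvCalibration.cliqueExtLowerBound_of_three hP hG (convHighDim_r4_of_r5 hH)

end Summit.PneNP.PneNP.Theorems.CliqueExtLowerBound.WidthThreshold.ConvCalibrationR5

end
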